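import Summits.Ventures.LatticeQCDFlow.Scaling.UrnCompositionChainLaw

/-!
HONEST FRAMING: exact (Metropolis-corrected) sampling algorithms for lattice gauge theory; figures
of merit are autocorrelation/cost numbers at stated couplings and volumes; no continuum-physics
claim.

# UrnCompositionStateSpace — A CONCRETE STATE SPACE FOR THE URN COMPOSITION CHAIN: THE BIJECTION HYPOTHESES OF FILES 7a/7b ARE MET BY
# `{N : S → Fin (K+2) // Σ_v N(v) = K+1}`, SO THE LAW-FREE MIXING LAW HOLDS THERE VERBATIM (lean-2 GEN-35, ours)

Venture-side (OURS).  Cell `lqcd-flow` (pub-lqcd), unit `pub-lqcd-lean-2-g35`, 2026-08-29.  Chapter V (composition variables), file 10.  Files 7a/7b (`UrnCompositionChainKernel`,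
`UrnCompositionChainLaw`) are stated on an abstract finite type `X` with a map `comp : X → S → ℕ` that is injective (`hinj`), lands in the compositions of `K+1` particles
(`hsum`) and reaches all of them (`hsurj`).  This file discharges those three hypotheses for the obvious finite type — functions `S → Fin (K+2)` with total `K+1`, `comp` the
coercion to `ℕ` — so that the law `t_mix(ε) ≤ ⌈((2K+4)/p)·log((K+1)(2K+4)/ε)⌉₊` of file 7b is available on a concrete state space with only the kernel, coupling and potential
given by hypothesis-equations.  No definitions (the state space is a subtype written inline).

## What is proved

* `urnSpace_sum` (`hsum`), `urnSpace_injective` (`hinj`), `urnSpace_surjective` (`hsurj`), `urnSpace_nonempty` (from `Nonempty S`).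
* **`urnSpace_mixingTime_le`** — file 7b's `urnChain_mixingTime_le` on this state space.

NOT CLAIMED: anything new mathematically.  Literature grade (cell rule): OWN, elementary; nothing cited as a fact; no new bib keys.
-/

open Finset Matrix
open Literature.Probability.MarkovChains

namespace Summit.Ventures.LatticeQCDFlow.Scaling

section UrnSpace
variable {S : Type*} [Fintype S] [DecidableEq S] {K : ℕ}

omit [DecidableEq S] in
/-- `hsum`: every point of the state space is a composition of `K + 1` particles. [ours] -/
theorem urnSpace_sum (x : {N : S → Fin (K + 2) // ∑ v, (N v : ℕ) = K + 1}) : ∑ v, (fun (y : {N : S → Fin (K + 2) // ∑ v, (N v : ℕ) = K + 1}) (v : S) => ((y.1 v : ℕ))) x v = K + 1 :=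
  x.2

omit [DecidableEq S] in
/-- `hinj`: the coercion to `ℕ`-valued compositions is injective. [ours] -/
theorem urnSpace_injective : Function.Injective (fun (y : {N : S → Fin (K + 2) // ∑ v, (N v : ℕ) = K + 1}) (v : S) => ((y.1 v : ℕ))) := by
  intro x y h
  apply Subtype.ext
  funext v
  exact Fin.ext (congrFun h v)

omit [DecidableEq S] in
/-- `hsurj`: every composition of `K + 1` particles is reached (each count is `≤ K + 1 < K + 2`). [ours] -/
theorem urnSpace_surjective (N : S → ℕ) (hN : ∑ v, N v = K + 1) :
    ∃ x : {N : S → Fin (K + 2) // ∑ v, (N v : ℕ) = K + 1}, (fun (y : {N : S → Fin (K + 2) // ∑ v, (N v : ℕ) = K + 1}) (v : S) => ((y.1 v : ℕ))) x = N := by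
  have hle : ∀ v, N v < K + 2 := fun v => by
    have : N v ≤ ∑ w, N w := single_le_sum (f := N) (fun w _ => Nat.zero_le _) (mem_univ v)
    omega
  refine ⟨⟨fun v => ⟨N v, hle v⟩, by simpa using hN⟩, ?_⟩
  funext v
  rfl

omit [DecidableEq S] in
/-- The state space is non-empty as soon as `S` is (put all `K + 1` particles on one content). [ours] -/
theorem urnSpace_nonempty [Nonempty S] [DecidableEq S] : Nonempty {N : S → Fin (K + 2) // ∑ v, (N v : ℕ) = K + 1} := by
  obtain ⟨c⟩ := (inferInstance : Nonempty S)
  have hlt : K + 1 < K + 2 := by omega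
  refine ⟨⟨fun v => if v = c then ⟨K + 1, hlt⟩ else ⟨0, by omega⟩, ?_⟩⟩
  rw [Finset.sum_eq_single c]
  · simp
  · intro v _ hv; simp [hv]
  · intro h; exact absurd (mem_univ c) h

/-- **THE URN LAW ON THE CONCRETE STATE SPACE:** with `X = {N : S → Fin (K+2) // Σ N = K+1}`, `comp` the coercion, and the kernel, coupling and potential of files 7a/7b given by
hypothesis-equations: `t_mix(ε) ≤ ⌈(1/(p/(2K+4)))·log((K+1)(2K+4)/ε)⌉₊` for every finite content type and every pair of laws with `p·μ_1 ≤ μ_0`, `0 < p`. [ours] -/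
theorem urnSpace_mixingTime_le [Nonempty S] {W θ μ0 : S → ℝ} {p : ℝ} {Zc : {N : S → Fin (K + 2) // ∑ v, (N v : ℕ) = K + 1} → ℝ}
    {u : {N : S → Fin (K + 2) // ∑ v, (N v : ℕ) = K + 1} → S → ℝ}
    {P : {N : S → Fin (K + 2) // ∑ v, (N v : ℕ) = K + 1} → {N : S → Fin (K + 2) // ∑ v, (N v : ℕ) = K + 1} → ℝ}
    {Q : Matrix ({N : S → Fin (K + 2) // ∑ v, (N v : ℕ) = K + 1} × {N : S → Fin (K + 2) // ∑ v, (N v : ℕ) = K + 1})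
      ({N : S → Fin (K + 2) // ∑ v, (N v : ℕ) = K + 1} × {N : S → Fin (K + 2) // ∑ v, (N v : ℕ) = K + 1}) ℝ}
    {Δ : (S → ℕ) → (S → ℕ) → ℕ} {Ψ : {N : S → Fin (K + 2) // ∑ v, (N v : ℕ) = K + 1} × {N : S → Fin (K + 2) // ∑ v, (N v : ℕ) = K + 1} → ℝ}
    (hW : ∀ v, 0 < W v) (hp0 : 0 < p) (hp : ∀ v, p * W v ≤ 1)
    (hθ : ∀ v, θ v = 1 / (1 + p * W v)) (hμ0 : ∀ v, 0 ≤ μ0 v) (hμ1 : ∑ v, μ0 v = 1) (hμW : ∑ v, μ0 v * W v = 1)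
    (hZ : ∀ x, Zc x = ∑ v, ((x.1 v : ℕ) : ℝ) / W v) (hu : ∀ x v, u x v = ((x.1 v : ℕ) : ℝ) / W v / Zc x)
    (hΔ : ∀ N N', Δ N N' = ∑ v, (N v - N' v))
    (hP : ∀ x x', P x x' = ∑ a, ∑ z, u x a * μ0 z
      * (if (fun v => (x'.1 v : ℕ)) + Pi.single a 1 = (fun v => (x.1 v : ℕ)) + Pi.single z 1 then (1 : ℝ) else 0))
    (hQ : ∀ x y x' y', Q (x, y) (x', y') = ∑ a, ∑ b, ∑ z, optimalCoupling (u x) (u y) a b * μ0 z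
      * (if (fun v => (x'.1 v : ℕ)) + Pi.single a 1 = (fun v => (x.1 v : ℕ)) + Pi.single z 1 then (1 : ℝ) else 0)
      * (if (fun v => (y'.1 v : ℕ)) + Pi.single b 1 = (fun v => (y.1 v : ℕ)) + Pi.single z 1 then (1 : ℝ) else 0))
    (hΨ : ∀ x y, Ψ (x, y) = (Δ (fun v => (x.1 v : ℕ)) (fun v => (y.1 v : ℕ)) : ℝ)
      * (2 + ∑ v, θ v * (((x.1 v : ℕ) : ℝ)) + ∑ v, θ v * (((y.1 v : ℕ) : ℝ))))
    {π : {N : S → Fin (K + 2) // ∑ v, (N v : ℕ) = K + 1} → ℝ} (hπ : IsStationary π P) (hπ0 : ∀ x, 0 ≤ π x) (hπ1 : ∑ x, π x = 1)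
    {ε : ℝ} (hε : 0 < ε) :
    mixingTime P π ε ≤ ⌈1 / (p / (2 * K + 4)) * Real.log ((K + 1) * (2 * K + 4) / ε)⌉₊ := by
  haveI := (urnSpace_nonempty (S := S) (K := K))
  exact urnChain_mixingTime_le (comp := fun (y : {N : S → Fin (K + 2) // ∑ v, (N v : ℕ) = K + 1}) (v : S) => ((y.1 v : ℕ)))
    urnSpace_injective urnSpace_sum urnSpace_surjective hW hp0 hp hθ hμ0 hμ1 hμW hZ hu hΔ hP hQ hΨ hπ hπ0 hπ1 hε

end UrnSpace

end Summit.Ventures.LatticeQCDFlow.Scaling
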